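import Summits.CriticalPhenomena.PercolationContinuityZ3.Theorems.PercAnnulusCrossingIICTailTrivial
import Summits.CriticalPhenomena.PercolationContinuityZ3.Theorems.FK.ConditionalEnergyGeneric
import HarnessLib

/-!
# UNIFORM MIXING OF KESTEN'S IIC: the absolute-regularity coefficient between `𝓕_S` and `𝓕_{Λ(K)ᶜ}` tends to `0` (lane RSW3, p1 gen 10)

builds on p205010 (kernel theorem, internal audit signed; external expert review pending) — used only through `θ(p_c) = 0` in the
`criticalProbI` / `ℤ²` corollaries.

Seat `prim-rsw3-p1` (gen 10); memo `run/shared/lean/prim/rsw3/P1-QM.md` §23.  Helper file; no definitions, no sorries.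

`…IICTailTrivial` gives, for a tail-trivial `ν` and each FIXED event `A`, a scale `K(A, ε)` beyond which every far event decorrelates from `A` to within
`ε`.  For the events of a finite set of pairs `S` the scale can be chosen UNIFORMLY: `𝓕_S` is generated by the `2^{|S|}` pattern cylinders
`[T]_S = {ω | ω ∩ S = T}` (`localCylinder`), every `D ∈ 𝓕_S` is a disjoint union of them (the FK cell's
`FK.Tolerance.real_inter_eq_sum_real_inter_localCylinder`), and one takes the largest of the `2^{|S|}` scales:

* **`exists_forall_forall_abs_real_inter_sub_mul_le_of_isTailTrivial`** — `ν` tail trivial, `S` finite, `ε > 0` ⇒ there is `K` with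
  `|ν(D ∩ G) − ν(D)·ν(G)| ≤ ε` for EVERY measurable `D` determined by `S` and EVERY measurable `G` determined by the pairs outside `Λ(K).sym2`
  (the β-mixing / absolute-regularity coefficient `β(𝓕_S, 𝓕_{Λ(K)ᶜ}) → 0` as `K → ∞`);
* **`iicMeasure_uniform_mixing_criticalProbI`** (`p_c(ℤ^d)`, `d ≥ 2`, (A2)□ at aspect `(s,L)`, `2 ≤ s`; every IIC probability measure),
  **`iicMeasure_uniform_mixing_Z2`** (Kesten's planar IIC, unconditional).
References: H.-O. Georgii, *Gibbs Measures and Phase Transitions* (2011), Prop. 7.9; H. Kesten, PTRF 73 (1986) Thm (3); D. Basu, A. Sapozhnikov,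
ECP 22 (2017) no. 26.
-/

noncomputable section

namespace Summit.CriticalPhenomena.PercolationContinuityZ3.Theorems.Crossing

open MeasureTheory Filter Topology Literature.Probability.Percolation Literature.Probability.LatticeModels
open Literature.Probability.Percolation.DCT16
open Summit.CriticalPhenomena.PercolationContinuityZ3.Theorems.SurfaceTension
open scoped Literature.Probability.Percolation ENNReal

variable {d : ℕ}

/-- **UNIFORM MIXING (β-mixing) FROM TAIL TRIVIALITY**: for a tail-trivial probability measure `ν` on `Set (Sym2 (Site d))`, a finite set of pairs `S` and
`ε > 0`, there is `K` such that `|ν(D ∩ G) − ν(D)·ν(G)| ≤ ε` for EVERY measurable `D` determined by `S` and EVERY measurable `G` determined by the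
pairs outside `Λ(K).sym2`.  (Decompose `D` over the `2^{|S|}` pattern cylinders of `S` and apply `…IICTailTrivial` to each.) [cite: Georgii2011, Prop. 7.9] -/
theorem exists_forall_forall_abs_real_inter_sub_mul_le_of_isTailTrivial {ν : Measure (BondConfig (Site d))} [IsProbabilityMeasure ν]
    (hT : IsTailTrivial (V := Sym2 (Site d)) (S := Prop) ν) (S : Finset (Sym2 (Site d))) {ε : ℝ} (hε : 0 < ε) :
    ∃ K : ℕ, ∀ D : Set (BondConfig (Site d)), MeasurableSet D → DeterminedBy D (↑S : Set (Sym2 (Site d))) →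
      ∀ G : Set (BondConfig (Site d)), MeasurableSet G →
        DeterminedBy G {e : Sym2 (Site d) | e ∉ (↑((box d K).sym2) : Set (Sym2 (Site d)))} →
          |ν.real (D ∩ G) - ν.real D * ν.real G| ≤ ε := by
  classical
  set N : ℕ := S.powerset.card with hN
  have hNpos : 0 < (N : ℝ) := by
    have : 0 < N := Finset.card_pos.2 ⟨∅, Finset.empty_mem_powerset S⟩
    exact_mod_cast this
  have hεN : 0 < ε / N := div_pos hε hNpos
  -- one scale per pattern cylinder
  have hcyl : ∀ T : Finset (Sym2 (Site d)), ∃ K : ℕ, ∀ G : Set (BondConfig (Site d)), MeasurableSet G →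
      DeterminedBy G {e : Sym2 (Site d) | e ∉ (↑((box d K).sym2) : Set (Sym2 (Site d)))} →
        |ν.real (localCylinder (↑S : Set (Sym2 (Site d))) ↑T ∩ G) - ν.real (localCylinder (↑S : Set (Sym2 (Site d))) ↑T) * ν.real G| ≤ ε / N :=
    fun T => exists_forall_abs_real_inter_sub_mul_le_of_isTailTrivial hT
      (measurableSet_localCylinder (S.countable_toSet) _) hεN
  choose K hK using hcyl
  refine ⟨S.powerset.sup K, fun D hDm hD G hGm hG => ?_⟩
  -- decompose `D` over the pattern cylinders of `S`
  set 𝒯 := S.powerset.filter (fun T : Finset (Sym2 (Site d)) => (↑T : Set (Sym2 (Site d))) ∈ D) with h𝒯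
  have h1 : ν.real (D ∩ G) = ∑ T ∈ 𝒯, ν.real (localCylinder (↑S : Set (Sym2 (Site d))) ↑T ∩ G) := by
    rw [Set.inter_comm, FK.Tolerance.real_inter_eq_sum_real_inter_localCylinder ν hGm hD]
    exact Finset.sum_congr rfl fun T _ => by rw [Set.inter_comm]
  have h2 : ν.real D = ∑ T ∈ 𝒯, ν.real (localCylinder (↑S : Set (Sym2 (Site d))) ↑T) :=
    FK.Tolerance.real_eq_sum_real_localCylinder ν hD
  have hGK : ∀ T ∈ 𝒯, DeterminedBy G {e : Sym2 (Site d) | e ∉ (↑((box d (K T)).sym2) : Set (Sym2 (Site d)))} := by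
    intro T hT
    have hT' : T ∈ S.powerset := (Finset.mem_filter.1 hT).1
    refine hG.mono fun e he heK => he ?_
    exact Finset.mem_coe.2 (Finset.sym2_mono (box_mono d (Finset.le_sup hT')) (Finset.mem_coe.1 heK))
  rw [h1, h2, Finset.sum_mul, ← Finset.sum_sub_distrib]
  calc |∑ T ∈ 𝒯, (ν.real (localCylinder (↑S : Set (Sym2 (Site d))) ↑T ∩ G) - ν.real (localCylinder (↑S : Set (Sym2 (Site d))) ↑T) * ν.real G)|
      ≤ ∑ T ∈ 𝒯, |ν.real (localCylinder (↑S : Set (Sym2 (Site d))) ↑T ∩ G) - ν.real (localCylinder (↑S : Set (Sym2 (Site d))) ↑T) * ν.real G| :=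
        Finset.abs_sum_le_sum_abs _ _
    _ ≤ ∑ _T ∈ 𝒯, ε / N := Finset.sum_le_sum fun T hT => hK T G hGm (hGK T hT)
    _ = 𝒯.card * (ε / N) := by rw [Finset.sum_const, nsmul_eq_mul]
    _ ≤ N * (ε / N) := by
        refine mul_le_mul_of_nonneg_right ?_ hεN.le
        exact_mod_cast Finset.card_filter_le _ _
    _ = ε := by field_simp

/-- **UNIFORM MIXING OF KESTEN'S IIC AT `p_c(ℤ^d)`** (`d ≥ 2`, (A2)□ at aspect `(s, L)`, `2 ≤ s`): for every IIC probability measure `ν`, every finite set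
of pairs `S` and every `ε > 0` there is `K` with `|ν(D ∩ G) − ν(D)·ν(G)| ≤ ε` simultaneously for all measurable `D` determined by `S` and all measurable
`G` determined by the pairs outside `Λ(K).sym2`. [cite: Georgii2011, Prop. 7.9] [cite: BasuSapozhnikov2017ECP, Thm. 1.1] [cite: Kesten1986, Thm. (3)] -/
theorem iicMeasure_uniform_mixing_criticalProbI (hd : 2 ≤ d) {s L : ℕ} (hs : 2 ≤ s) {ϰ : ℝ} (hϰ : 0 < ϰ)
    (hA2 : SetToSetQuasiMultAspectAt d (criticalProbI d) s L ϰ)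
    {ν : Measure (BondConfig (Site d))} [IsProbabilityMeasure ν]
    (hν : ∀ (F : Finset (Sym2 (Site d))) (E : Set (BondConfig (Site d))), MeasurableSet E → DeterminedBy E ↑F →
      Tendsto (fun n : ℕ => (bondPercolation (zdGraph d) (criticalProbI d)).real (E ∩ siteToBoundary d n) /
        oneArmProb d (criticalProbI d) n) atTop (𝓝 (ν.real E)))
    (S : Finset (Sym2 (Site d))) {ε : ℝ} (hε : 0 < ε) :
    ∃ K : ℕ, ∀ D : Set (BondConfig (Site d)), MeasurableSet D → DeterminedBy D (↑S : Set (Sym2 (Site d))) →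
      ∀ G : Set (BondConfig (Site d)), MeasurableSet G →
        DeterminedBy G {e : Sym2 (Site d) | e ∉ (↑((box d K).sym2) : Set (Sym2 (Site d)))} →
          |ν.real (D ∩ G) - ν.real D * ν.real G| ≤ ε :=
  exists_forall_forall_abs_real_inter_sub_mul_le_of_isTailTrivial (iicMeasure_isTailTrivial_criticalProbI hd hs hϰ hA2 hν) S hε

/-- **UNIFORM MIXING OF KESTEN'S PLANAR IIC, unconditionally** (every probability measure with the IIC limit property at `p_c(ℤ²)`).
[cite: Georgii2011, Prop. 7.9] [cite: Kesten1986, Thm. (3)] -/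
theorem iicMeasure_uniform_mixing_Z2 {ν : Measure (BondConfig (Site 2))} [IsProbabilityMeasure ν]
    (hν : ∀ (F : Finset (Sym2 (Site 2))) (E : Set (BondConfig (Site 2))), MeasurableSet E → DeterminedBy E ↑F →
      Tendsto (fun n : ℕ => (bondPercolation (zdGraph 2) (criticalProbI 2)).real (E ∩ siteToBoundary 2 n) /
        oneArmProb 2 (criticalProbI 2) n) atTop (𝓝 (ν.real E)))
    (S : Finset (Sym2 (Site 2))) {ε : ℝ} (hε : 0 < ε) :
    ∃ K : ℕ, ∀ D : Set (BondConfig (Site 2)), MeasurableSet D → DeterminedBy D (↑S : Set (Sym2 (Site 2))) →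
      ∀ G : Set (BondConfig (Site 2)), MeasurableSet G →
        DeterminedBy G {e : Sym2 (Site 2) | e ∉ (↑((box 2 K).sym2) : Set (Sym2 (Site 2)))} →
          |ν.real (D ∩ G) - ν.real D * ν.real G| ≤ ε :=
  exists_forall_forall_abs_real_inter_sub_mul_le_of_isTailTrivial (iicMeasure_isTailTrivial_Z2 hν) S hε

end Summit.CriticalPhenomena.PercolationContinuityZ3.Theorems.Crossing

end
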